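import Literature.Computability.Complexity.MajorityEnumeration
import Literature.Computability.Complexity.SpaceLoop
import HarnessLib

/-!
# The certificate-enumeration loop of `∃ᵖ·PSPACE ⊆ PSPACE` as an `FP` step function

Trunk toolkit towards the named fact `polyExists_PSPACE_subset_PSPACE` (`SpaceOracles.lean`;
Homer–Selman 2011, Thm. 5.10 / Cor. 5.7: `NTIME(T) ⊆ DSPACE(T)`, `NP ⊆ PSPACE`, by enumerating
the choice strings "lexicographically" (p. 93: "let `x + 1` denote the lexicographically next
string after `x` … if the length of `x + 1` is greater …") and re-running the machine in the
space of one computation; used relativized in the proof of Prop. 7.5, "`NP^PSPACE = PSPACE`").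
For the tree's certificate operator `polyExists` (`x ∈ L ↔ ∃ y, |y| ≤ p |x| ∧ ⟨x, y⟩ ∈ L'`) and
the loop machine of `SpaceLoop.lean` / `SpaceLoopBounded.lean` iterating the composite of a
polynomial-time ROUND FUNCTION with the query transducer of `SpaceQueryMachine.lean` (which turns
a query word `0 q` into `0 [q ∈ L'] q`), this file supplies the round function and its complete
orbit analysis. No machine is written: everything is in the tree's `FP` algebra.

* `PolyExistsEnum.next`, `PolyExistsEnum.cand k = next^[k] []`: the enumeration of all strings
  by (length, value) — `[]`, `0`, `1`, `00`, `10`, `01`, `11`, `000`, … (little-endian successor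
  `TokConv.ib`, carry `TokConv.co`, `TokenStreams.lean`); `cand (2^ℓ - 1 + i) = natBits ℓ i`
  (`cand_two_pow_add`), so every string of length `≤ m` occurs at an index `≤ 2^{m+1} - 2`
  (`exists_cand_eq`), and no earlier index is a stopping point (`not_isLast_of_lt`).
* `PolyExistsEnum.enumFn p ∈ FP` (`enumFn_mem_FP`): `0 x ↦ 0 ⟨x, []⟩` (first query);
  `1 0 b ⟨x, y⟩ ↦ 1 1` if the answer bit `b` is `1` (accept), else `0 ⟨x, next y⟩` (next query)
  unless `y = 1^{|y|}` with `|y| + 1 > p |x|`, in which case `1 0` (reject)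
  (`enumFn_false`, `enumFn_true`, `laterFn_accept`, `laterFn_reject`, `stepQ_boolPair`).
* **Orbit** (`orbit_eq_of_le`, `orbit_stop`, `orbit_spec`): for any "answering" map `G`
  (`G (0 q) = 0 [q ∈ A] q`, `G (1 r) = 1 r` — the function of the query transducer) the
  `SpaceLoop.orbit` of `G ∘ enumFn p` on `x` is `0 bₖ ⟨x, cand k⟩` (`bₖ = [⟨x, cand k⟩ ∈ A]`,
  `|cand k| ≤ p |x|`) up to the first stopping index `K` and then the flagged word `1 a` with
  `a = [x ∈ L]` for any `L` with `x ∈ L ↔ ∃ y, |y| ≤ p |x| ∧ ⟨x, y⟩ ∈ A`; corollaries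
  `orbit_length_le` (words of length `≤ 2|x| + p |x| + 4` until the flag) and `orbit_halts` in
  the exact shape consumed by `SpaceLoop.mem_PSPACE_of_space`.

## References

* S. Homer, A. L. Selman, *Computability and Complexity Theory*, 2nd ed., Springer 2011,
  Thm. 5.10 (proof, steps 1–4: the breadth-first enumeration of choice strings), Cor. 5.7,
  proof of Prop. 7.5. [HomerSelman2011]
* S. Arora, B. Barak, *Computational Complexity: A Modern Approach*, CUP 2009, Def. 2.1
  (certificates), §4.1 (`NP ⊆ PSPACE`: "enumerate all possible certificates, reusing space"),
  §1.3 (closure of polynomial time under composition). [AroraBarak2009]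

## Design notes

* The enumeration state is the candidate `y` itself, recoverable from the query `⟨x, y⟩` that the
  transducer hands back (`Brick.fstF`, `Brick.sndF`), so no state has to bypass the query.
* `next y` grows the length exactly at the all-ones strings (carry out of the successor), where
  the length test `lenLeFn p ⟨x, 0 y⟩ = [ |y| + 1 ≤ p |x| ]` (`LengthCompare.lean`) decides
  between the next length and rejection; the orbit analysis is index arithmetic on `cand`.
-/

noncomputable section

namespace Literature.Computability.Complexity

open _root_.Computability Polynomial Brick CoinEnum SpaceLoop

namespace PolyExistsEnum

/-! ### The enumeration of all strings by (length, value) -/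

/-- **The successor of a candidate**: the little-endian successor `TokConv.ib true y` of the same
length, except at the all-ones strings (carry out), where the enumeration moves on to the zero
string of the next length. [cite: HomerSelman2011, Thm. 5.10 (proof, step 4: "the lexicographically next string")] -/
def next (y : List Bool) : List Bool :=
  if TokConv.co true y = true then List.replicate (y.length + 1) false else TokConv.ib true y

/-- **The `k`-th candidate**: `cand k = next^[k] []`, i.e. `[]`, `0`, `1`, `00`, `10`, `01`, `11`,
`000`, …. [cite: HomerSelman2011, Thm. 5.10 (proof)] -/
def cand (k : ℕ) : List Bool := next^[k] []

/-- `cand 0 = []`. [folklore] -/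
@[simp] theorem cand_zero : cand 0 = [] := rfl

/-- `cand (k + 1) = next (cand k)`. [folklore] -/
theorem cand_succ (k : ℕ) : cand (k + 1) = next (cand k) :=
  Function.iterate_succ_apply' next k []

/-- Length of the successor: it grows by one exactly at a carry out. [folklore] -/
theorem length_next (y : List Bool) :
    (next y).length = if TokConv.co true y = true then y.length + 1 else y.length := by
  unfold next
  split_ifs <;> simp

/-- **The block structure of the enumeration**: the strings of length `ℓ` are enumerated in the
order of their values, `cand (2^ℓ - 1 + i) = natBits ℓ i` for `i < 2^ℓ`. [folklore] -/
theorem cand_two_pow_add : ∀ (ℓ i : ℕ), i < 2 ^ ℓ → cand (2 ^ ℓ - 1 + i) = natBits ℓ i := by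
  intro ℓ
  induction ℓ with
  | zero =>
    intro i hi
    have hi0 : i = 0 := by simpa using hi
    subst hi0
    rfl
  | succ ℓ ih =>
    have hpos : 0 < 2 ^ ℓ := Nat.two_pow_pos ℓ
    have hpow : 2 ^ (ℓ + 1) = 2 * 2 ^ ℓ := by rw [pow_succ, Nat.mul_comm]
    -- the first string of the block: `0^{ℓ+1}`, the successor of `1^ℓ`
    have h0 : cand (2 ^ (ℓ + 1) - 1) = natBits (ℓ + 1) 0 := by
      have e : 2 ^ (ℓ + 1) - 1 = (2 ^ ℓ - 1 + (2 ^ ℓ - 1)) + 1 := by omega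
      rw [e, cand_succ, ih _ (by omega), next, if_pos (co_natBits_last ℓ), length_natBits,
        natBits_zero]
    intro i
    induction i with
    | zero => intro _; simpa using h0
    | succ i ihi =>
      intro hi
      have hlt : i + 1 < 2 ^ (ℓ + 1) := hi
      rw [← Nat.add_assoc, cand_succ, ihi (by omega), next, if_neg (by rw [co_natBits_of_lt hlt]; decide),
        ib_natBits_of_lt hlt]

/-- Every index decomposes as `2^ℓ - 1 + i` with `i < 2^ℓ` (block `ℓ`, position `i`). [folklore] -/
theorem exists_block (k : ℕ) : ∃ ℓ i : ℕ, i < 2 ^ ℓ ∧ k = 2 ^ ℓ - 1 + i := by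
  induction k with
  | zero => exact ⟨0, 0, by simp, by simp⟩
  | succ k ih =>
    obtain ⟨ℓ, i, hi, rfl⟩ := ih
    by_cases h : i + 1 < 2 ^ ℓ
    · exact ⟨ℓ, i + 1, h, by omega⟩
    · refine ⟨ℓ + 1, 0, Nat.two_pow_pos _, ?_⟩
      have hpow : 2 ^ (ℓ + 1) = 2 * 2 ^ ℓ := by rw [pow_succ, Nat.mul_comm]
      omega

/-- **Every string is a candidate**, at an index `≤ 2^{|y|+1} - 2`. [folklore] -/
theorem exists_cand_eq (y : List Bool) : ∃ k ≤ 2 ^ (y.length + 1) - 2, cand k = y := by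
  have hlt := bitsToNat_lt y
  refine ⟨2 ^ y.length - 1 + bitsToNat y, ?_, ?_⟩
  · have hpow : 2 ^ (y.length + 1) = 2 * 2 ^ y.length := by rw [pow_succ, Nat.mul_comm]
    omega
  · rw [cand_two_pow_add _ _ hlt, natBits_bitsToNat]

/-- The stopping condition of the enumeration at a candidate `y` with length budget `m`: `y` is an
all-ones string (carry out of the successor) and the next length would exceed `m`. [folklore] -/
def IsLast (m : ℕ) (y : List Bool) : Prop :=
  TokConv.co true y = true ∧ ¬ (y.length + 1 ≤ m)

/-- **No candidate before index `2^{m+1} - 2` is a stopping point** for the budget `m`: in block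
`ℓ` only the last string `1^ℓ` carries out, and its successor has length `ℓ + 1 ≤ m` unless
`ℓ = m`. [folklore] -/
theorem not_isLast_of_lt {m k : ℕ} (hk : k < 2 ^ (m + 1) - 2) : ¬ IsLast m (cand k) := by
  obtain ⟨ℓ, i, hi, rfl⟩ := exists_block k
  rintro ⟨hco, hlen⟩
  rw [cand_two_pow_add ℓ i hi, length_natBits] at *
  rcases Nat.lt_or_ge (i + 1) (2 ^ ℓ) with h | h
  · rw [co_natBits_of_lt h] at hco
    exact Bool.false_ne_true hco
  · -- `i = 2^ℓ - 1`: the index is `2^{ℓ+1} - 2`, so `ℓ < m`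
    have hi' : i = 2 ^ ℓ - 1 := by omega
    subst hi'
    have hℓ : m ≤ ℓ := by omega
    have hpow : 2 ^ (m + 1) ≤ 2 ^ (ℓ + 1) := Nat.pow_le_pow_right (by norm_num) (by omega)
    have hpow' : 2 ^ (ℓ + 1) = 2 * 2 ^ ℓ := by rw [pow_succ, Nat.mul_comm]
    omega

/-- The last string of block `m`, `cand (2^{m+1} - 2) = 1^m = natBits m (2^m - 1)`, IS a stopping
point for the budget `m`. [folklore] -/
theorem isLast_cand_two_pow (m : ℕ) : IsLast m (cand (2 ^ (m + 1) - 2)) := by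
  have hpos : 0 < 2 ^ m := Nat.two_pow_pos m
  have hpow : 2 ^ (m + 1) = 2 * 2 ^ m := by rw [pow_succ, Nat.mul_comm]
  have e : 2 ^ (m + 1) - 2 = 2 ^ m - 1 + (2 ^ m - 1) := by omega
  rw [e, IsLast, cand_two_pow_add _ _ (by omega), length_natBits]
  exact ⟨co_natBits_last m, by omega⟩

/-! ### The round function -/

section Step

variable (p : Polynomial ℕ)

/-- On a query body `⟨x, y⟩`: the next query at the next length, `0 ⟨x, 0^{|y|+1}⟩`. [folklore] -/
def growFn : List Bool → List Bool :=
  List.cons false ∘ fanoutFn fstF (List.cons false ∘ Kannan.zerosFn ∘ sndF)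

/-- On a query body `⟨x, y⟩`: the length test `[ |y| + 1 ≤ p |x| ]` (`lenLeFn`, `LengthCompare.lean`).
[folklore] -/
def growTest : List Bool → List Bool :=
  lenLeFn p ∘ fanoutFn fstF (List.cons false ∘ sndF)

/-- On a query body `⟨x, y⟩`: the next query at the same length, `0 ⟨x, succ y⟩` (`CoinEnum.incFn`).
[folklore] -/
def incQ : List Bool → List Bool :=
  List.cons false ∘ fanoutFn fstF (incFn ∘ sndF)

/-- **One enumeration step on a query body `⟨x, y⟩`** (`y` rejected): if `y` is not all-ones,
the next query `0 ⟨x, succ y⟩`; if it is (`CoinEnum.carryFn`), either the next query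
`0 ⟨x, 0^{|y|+1}⟩` when `|y| + 1 ≤ p |x|`, or the verdict `1 0` (all certificates rejected).
[cite: HomerSelman2011, Thm. 5.10 (proof, step 4)] -/
def stepQ : List Bool → List Bool :=
  iteFn (carryFn ∘ sndF) (iteFn (growTest p) (growFn) (fun _ => [true, false])) (incQ)

/-- The round function on a later-round word `0 b q` (the tag `1` already stripped): accept
(`1 1`) if the answer bit `b` of the previous query is `1`, otherwise `stepQ` on `q`. [folklore] -/
def laterFn : List Bool → List Bool :=
  iteFn (take1Fn ∘ List.tail) (fun _ => [true, true]) (stepQ p ∘ List.tail ∘ List.tail)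

/-- The round function on the first-round word (the tag `0` already stripped): the first query
`0 ⟨x, []⟩`. [folklore] -/
def initOut : List Bool → List Bool :=
  List.cons false ∘ fanoutFn id (fun _ => [])

/-- **The round function of the certificate enumeration**: `0 x ↦ 0 ⟨x, []⟩`;
`1 0 b q ↦ laterFn p (0 b q)`. [cite: HomerSelman2011, Thm. 5.10 (proof) and Cor. 5.7; proof of Prop. 7.5 (NP^PSPACE = PSPACE)] -/
def enumFn : List Bool → List Bool :=
  iteFn take1Fn (laterFn p ∘ List.tail) (initOut ∘ List.tail)

/-- First round: `enumFn p (0 x) = 0 ⟨x, []⟩`. [folklore] -/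
theorem enumFn_false (x : List Bool) : enumFn p (false :: x) = false :: boolPair x [] := by
  rw [enumFn, iteFn_apply_false (show take1Fn (false :: x) = [false] from rfl)]
  simp [initOut]

/-- Later rounds: `enumFn p (1 r) = laterFn p r`. [folklore] -/
theorem enumFn_true (r : List Bool) : enumFn p (true :: r) = laterFn p r := by
  rw [enumFn, iteFn_apply_true (show take1Fn (true :: r) = [true] from rfl)]
  rfl

/-- A previous query answered `1`: accept. [folklore] -/
theorem laterFn_accept (q : List Bool) : laterFn p (false :: true :: q) = [true, true] := by
  rw [laterFn, iteFn_apply_true (show (take1Fn ∘ List.tail) (false :: true :: q) = [true] from rfl)]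

/-- A previous query answered `0`: step. [folklore] -/
theorem laterFn_reject (q : List Bool) : laterFn p (false :: false :: q) = stepQ p q := by
  rw [laterFn, iteFn_apply_false (show (take1Fn ∘ List.tail) (false :: false :: q) = [false] from rfl)]
  rfl

/-- **The enumeration step on `⟨x, y⟩`.** [cite: HomerSelman2011, Thm. 5.10 (proof, step 4)] -/
theorem stepQ_boolPair (x y : List Bool) :
    stepQ p (boolPair x y) =
      if TokConv.co true y = true then
        (if y.length + 1 ≤ p.eval x.length then false :: boolPair x (List.replicate (y.length + 1) false)
          else [true, false])
      else false :: boolPair x (TokConv.ib true y) := by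
  have hc : (carryFn ∘ sndF) (boolPair x y) = [TokConv.co true y] := by
    simp [Function.comp_apply]
  have ht : growTest p (boolPair x y) = [decide (y.length + 1 ≤ p.eval x.length)] := by
    simp [growTest, Function.comp_apply, lenLeFn_boolPair]
  cases hco : TokConv.co true y
  · rw [stepQ, iteFn_apply_false (by rw [hc, hco])]
    simp [incQ]
  · rw [stepQ, iteFn_apply_true (by rw [hc, hco])]
    by_cases hl : y.length + 1 ≤ p.eval x.length
    · rw [iteFn_apply_true (by rw [ht, decide_eq_true hl]), if_pos rfl, if_pos hl]
      simp [growFn, List.replicate_succ]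
    · rw [iteFn_apply_false (by rw [ht, decide_eq_false hl]), if_pos rfl, if_neg hl]

/-- The step at a non-stopping candidate produces the next query. [folklore] -/
theorem stepQ_of_not_isLast (x y : List Bool) (h : ¬ IsLast (p.eval x.length) y) :
    stepQ p (boolPair x y) = false :: boolPair x (next y) := by
  rw [stepQ_boolPair, next]
  by_cases hco : TokConv.co true y = true
  · have hl : y.length + 1 ≤ p.eval x.length := by
      by_contra hl; exact h ⟨hco, hl⟩
    rw [if_pos hco, if_pos hl, if_pos hco]
  · rw [if_neg hco, if_neg hco]

/-- The step at a stopping candidate rejects. [folklore] -/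
theorem stepQ_of_isLast (x y : List Bool) (h : IsLast (p.eval x.length) y) :
    stepQ p (boolPair x y) = [true, false] := by
  rw [stepQ_boolPair, if_pos h.1, if_neg h.2]

/-- **The round function is in `FP`** (bricks: `iteFn`, `fanoutFn`, `Brick.fstF`/`sndF`,
`CoinEnum.incFn`/`carryFn`, `lenLeFn`, `Kannan.zerosFn`, `take1Fn`, `List.tail`, constants).
[cite: AroraBarak2009, §1.3 (closure of polynomial time under composition)] -/
theorem enumFn_mem_FP : enumFn p ∈ FP := by
  have hgrow : growFn ∈ FP :=
    comp_mem_FP (cons_mem_FP false) (fanoutFn_mem_FP fstF_mem_FP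
      (comp_mem_FP (cons_mem_FP false) (comp_mem_FP Kannan.zerosFn_mem_FP sndF_mem_FP)))
  have htest : growTest p ∈ FP :=
    comp_mem_FP (lenLeFn_mem_FP p) (fanoutFn_mem_FP fstF_mem_FP (comp_mem_FP (cons_mem_FP false) sndF_mem_FP))
  have hinc : incQ ∈ FP :=
    comp_mem_FP (cons_mem_FP false) (fanoutFn_mem_FP fstF_mem_FP (comp_mem_FP incFn_mem_FP sndF_mem_FP))
  have hstep : stepQ p ∈ FP :=
    iteFn_mem_FP (comp_mem_FP carryFn_mem_FP sndF_mem_FP)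
      (iteFn_mem_FP htest hgrow (const_mem_FP _)) hinc
  have hlater : laterFn p ∈ FP :=
    iteFn_mem_FP (comp_mem_FP take1Fn_mem_FP PRelSigma.tail_mem_FP) (const_mem_FP _)
      (comp_mem_FP hstep (comp_mem_FP PRelSigma.tail_mem_FP PRelSigma.tail_mem_FP))
  have hinit : initOut ∈ FP :=
    comp_mem_FP (cons_mem_FP false) (fanoutFn_mem_FP OracleCompose.id_mem_FP (const_mem_FP _))
  exact iteFn_mem_FP take1Fn_mem_FP (comp_mem_FP hlater PRelSigma.tail_mem_FP)
    (comp_mem_FP hinit PRelSigma.tail_mem_FP)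

end Step

/-! ### The orbit of the answered round function -/

section Orbit

variable (p : Polynomial ℕ) (A : Language Bool) {G : List Bool → List Bool}

/-- The answer bit of the `k`-th query of input `x`: `[⟨x, cand k⟩ ∈ A]`. [folklore] -/
def bit (x : List Bool) (k : ℕ) : Bool := A.boolIndicator (boolPair x (cand k))

/-- The enumeration stops at index `k`: the `k`-th candidate is accepted, or it is a stopping
point of the enumeration for the budget `p |x|`. [folklore] -/
def Stop (x : List Bool) (k : ℕ) : Prop := bit A x k = true ∨ IsLast (p.eval x.length) (cand k)

/-- The enumeration stops at the latest at index `2^{p|x|+1} - 2`. [folklore] -/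
theorem exists_stop (x : List Bool) : ∃ k, Stop p A x k :=
  ⟨_, Or.inr (isLast_cand_two_pow (p.eval x.length))⟩

open Classical in
/-- **The stopping index** of input `x`: the first index at which the enumeration stops. [folklore] -/
def stopIdx (x : List Bool) : ℕ := Nat.find (exists_stop p A x)

open Classical in
/-- The enumeration stops at the stopping index. [folklore] -/
theorem stop_stopIdx (x : List Bool) : Stop p A x (stopIdx p A x) := Nat.find_spec (exists_stop p A x)

open Classical in
/-- The enumeration does not stop before the stopping index. [folklore] -/
theorem not_stop_of_lt {x : List Bool} {k : ℕ} (hk : k < stopIdx p A x) : ¬ Stop p A x k :=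
  Nat.find_min (exists_stop p A x) hk

/-- Before the stopping index the answer bits are `0`. [folklore] -/
theorem bit_eq_false_of_lt {x : List Bool} {k : ℕ} (hk : k < stopIdx p A x) : bit A x k = false := by
  have h := not_stop_of_lt p A hk
  rw [Stop, not_or] at h
  simpa using h.1

/-- **The candidates actually queried fit the budget**: `|cand k| ≤ p |x|` for `k ≤ stopIdx`.
[folklore] -/
theorem length_cand_le {x : List Bool} {k : ℕ} (hk : k ≤ stopIdx p A x) :
    (cand k).length ≤ p.eval x.length := by
  induction k with
  | zero => simp
  | succ k ih =>
    have hk' : k < stopIdx p A x := hk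
    have hns := not_stop_of_lt p A hk'
    rw [Stop, not_or, IsLast, not_and, not_not] at hns
    rw [cand_succ, length_next]
    split_ifs with hco
    · exact hns.2 hco
    · exact ih hk'.le

/-- **The final answer bit is `[x ∈ L]`** for any language `L` of which `(A, p)` is a
`polyExists` witness: an accepted candidate is a certificate within the length budget; if the
enumeration is exhausted without acceptance, every string of length `≤ p |x|` has been queried
and rejected. [cite: HomerSelman2011, Thm. 5.10 (proof: "It is clear that M correctly simulates N") and Cor. 5.7] -/
theorem bit_stopIdx_eq {L : Language Bool}
    (hL : ∀ x, x ∈ L ↔ ∃ y : List Bool, y.length ≤ p.eval x.length ∧ boolPair x y ∈ A) (x : List Bool) :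
    bit A x (stopIdx p A x) = L.boolIndicator x := by
  set K := stopIdx p A x with hK
  cases hb : bit A x K
  · -- exhausted: no certificate
    symm
    rw [← Bool.not_eq_true, ← ne_eq]
    intro hx
    rw [← Set.mem_iff_boolIndicator] at hx
    obtain ⟨y, hy, hyA⟩ := (hL x).1 hx
    obtain ⟨k₀, hk₀, hky⟩ := exists_cand_eq y
    -- the stopping index is the last index of block `m`
    have hKge : 2 ^ (p.eval x.length + 1) - 2 ≤ K := by
      by_contra hlt
      rw [not_le] at hlt
      rcases stop_stopIdx p A x with h | h
      · rw [← hK, hb] at h; exact Bool.false_ne_true h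
      · exact not_isLast_of_lt hlt (hK ▸ h)
    have hk₀K : k₀ ≤ K := by
      refine le_trans hk₀ (le_trans ?_ hKge)
      have := Nat.pow_le_pow_right (show 0 < 2 by norm_num) (Nat.succ_le_succ hy)
      omega
    have hbit : bit A x k₀ = true := by
      rw [bit, hky]; exact (Set.mem_iff_boolIndicator _ _).1 hyA
    rcases hk₀K.lt_or_eq with hlt | heq
    · rw [bit_eq_false_of_lt p A hlt] at hbit; exact Bool.false_ne_true hbit
    · rw [heq, hb] at hbit; exact Bool.false_ne_true hbit
  · -- accepted: a certificate within the budget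
    symm
    rw [← Set.mem_iff_boolIndicator]
    refine (hL x).2 ⟨cand K, length_cand_le p A le_rfl, ?_⟩
    exact (Set.mem_iff_boolIndicator _ _).2 hb

variable (hG₀ : ∀ q, G (false :: q) = false :: A.boolIndicator q :: q)
include hG₀

/-- **The orbit up to the stopping index**: the `k`-th word is the answered `k`-th query
`0 bₖ ⟨x, cand k⟩`. [cite: HomerSelman2011, Thm. 5.10 (proof) and proof of Prop. 7.5] -/
theorem orbit_eq_of_le (x : List Bool) {k : ℕ} (hk : k ≤ stopIdx p A x) :
    orbit (G ∘ enumFn p) x k = false :: bit A x k :: boolPair x (cand k) := by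
  induction k with
  | zero =>
    rw [orbit_zero, Function.comp_apply, enumFn_false, hG₀]
    rfl
  | succ k ih =>
    have hk' : k < stopIdx p A x := hk
    have hns := not_stop_of_lt p A hk'
    rw [Stop, not_or] at hns
    rw [orbit_succ, ih hk'.le, Function.comp_apply, enumFn_true, bit_eq_false_of_lt p A hk',
      laterFn_reject, stepQ_of_not_isLast p x _ hns.2, hG₀, ← cand_succ]
    rfl

variable (hG₁ : ∀ r, G (true :: r) = true :: r)
include hG₁

/-- **The orbit at the stopping index + 1**: the flagged word `1 a` with `a` the answer bit of
the stopping index. [cite: HomerSelman2011, Thm. 5.10 (proof, steps 3–4: accept, or reject when the strings are exhausted)] -/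
theorem orbit_stop (x : List Bool) :
    orbit (G ∘ enumFn p) x (stopIdx p A x + 1) = [true, bit A x (stopIdx p A x)] := by
  rw [orbit_succ, orbit_eq_of_le p A hG₀ x le_rfl, Function.comp_apply, enumFn_true]
  rcases stop_stopIdx p A x with h | h
  · rw [h, laterFn_accept, hG₁]
  · cases hb : bit A x (stopIdx p A x)
    · rw [laterFn_reject, stepQ_of_isLast p x _ h, hG₁]
    · rw [laterFn_accept, hG₁]

/-- **Specification of the orbit** (everything `SpaceLoop` needs): the orbit of `G ∘ enumFn p`
on `x` consists of the answered queries `0 bₖ ⟨x, cand k⟩`, `|cand k| ≤ p |x|`, for `k ≤ K`,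
followed by the flagged word `1 [x ∈ L]` at `K + 1`. [cite: HomerSelman2011, Thm. 5.10 and Cor. 5.7; proof of Prop. 7.5] -/
theorem orbit_spec {L : Language Bool}
    (hL : ∀ x, x ∈ L ↔ ∃ y : List Bool, y.length ≤ p.eval x.length ∧ boolPair x y ∈ A) (x : List Bool) :
    ∃ K, orbit (G ∘ enumFn p) x (K + 1) = [true, L.boolIndicator x] ∧
      ∀ k ≤ K, orbit (G ∘ enumFn p) x k = false :: bit A x k :: boolPair x (cand k) ∧
        (cand k).length ≤ p.eval x.length :=
  ⟨stopIdx p A x, by rw [orbit_stop p A hG₀ hG₁, bit_stopIdx_eq p A hL],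
    fun _ hk => ⟨orbit_eq_of_le p A hG₀ x hk, length_cand_le p A hk⟩⟩

/-- **The orbit raises the flag with the answer `[x ∈ L]`**, unflagged before (the halting
hypothesis of `SpaceLoop.mem_PSPACE_of_space`). [cite: HomerSelman2011, Thm. 5.10 and Cor. 5.7] -/
theorem orbit_halts {L : Language Bool}
    (hL : ∀ x, x ∈ L ↔ ∃ y : List Bool, y.length ≤ p.eval x.length ∧ boolPair x y ∈ A) (x : List Bool) :
    ∃ N w, orbit (G ∘ enumFn p) x N = true :: L.boolIndicator x :: w ∧
      ∀ k < N, ∃ w', orbit (G ∘ enumFn p) x k = false :: w' := by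
  obtain ⟨K, hK, hlt⟩ := orbit_spec p A hG₀ hG₁ hL x
  exact ⟨K + 1, [], hK, fun k hk => ⟨_, (hlt k (Nat.lt_succ_iff.1 hk)).1⟩⟩

/-- **The orbit words up to the flag have length `≤ 2|x| + p |x| + 4`** (the space hypothesis of
`SpaceLoop.mem_PSPACE_of_space`). [cite: HomerSelman2011, Thm. 5.10 (proof: "tape k+1 uses no more than T(n) cells")] -/
theorem orbit_length_le {L : Language Bool}
    (hL : ∀ x, x ∈ L ↔ ∃ y : List Bool, y.length ≤ p.eval x.length ∧ boolPair x y ∈ A) (x : List Bool)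
    (k : ℕ) (hk : ∀ j < k, ∃ w', orbit (G ∘ enumFn p) x j = false :: w') :
    (orbit (G ∘ enumFn p) x k).length ≤ (2 * X + p + 4 : Polynomial ℕ).eval x.length := by
  obtain ⟨K, hK, hle⟩ := orbit_spec p A hG₀ hG₁ hL x
  have hkK : k ≤ K + 1 := by
    by_contra h
    obtain ⟨w', hw'⟩ := hk (K + 1) (by omega)
    rw [hK] at hw'
    simp at hw'
  simp only [eval_add, eval_mul, eval_ofNat, eval_X]
  rcases hkK.lt_or_eq with h | rfl
  · obtain ⟨h1, h2⟩ := hle k (Nat.lt_succ_iff.1 h)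
    rw [h1]
    simp only [List.length_cons, length_boolPair]
    omega
  · rw [hK]; simp

end Orbit

end PolyExistsEnum

end Literature.Computability.Complexity

end
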